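import Summits.QuantumFields.YangMills.Theorems.UnitScaleTiltProp7ExpTaylorTwo
import Summits.QuantumFields.YangMills.Theorems.UnitScaleTiltProp7GSerSecondDiff
import Literature.Analysis.Calculus.BCHProductLowOrder
import HarnessLib

/-!
# Prop 7, route-R E′, (E1-c) brick F3c — THE PURE-GAUGE PIECE `P₂ = log(e^{−X}e^{X+H}) − H`: TRISECTION `M_X(H) + e^{−X}·R_exp(X;H) + [log(1+Φ) − Φ]` AND THE ROWS OF ITS NONLINEAR PART

Route `UnitScaleTilt`, crux K1 child «MinimiserStabilityRegPr» (`stmt-QuantumFields-19200`), cell ym3-torus, width seat px15 (gen 2); pen «px15 g2: (E1-c) GO-LOCATE» (★p1 g15,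
2026-08-28T20:45:05Z), LOCATE `LOCATE-E1C-DIVLIPSCHITZ-px15g2.md` §3∕§6.  THEOREMS ONLY (0 `def`, 0 `sorry`); `--supports stmt-QuantumFields-19200`, count-neutral.
YM₃ on T³ is a ladder rung (R3), not the Clay problem; nothing here claims the stub, the crux, d = 4 or the mass gap.

OBJECTS (written out; `X = iλ` the corrector at a site, `H = iδ` its covariant difference along a bond, `‖X‖,‖X′‖ ≤ R`, `‖H‖,‖H′‖ ≤ K`, `K ≍ ℓ⁻¹`):
`Φ(X;H) := e^{−X}(e^{X+H} − e^X) = e^{−X}e^{X+H} − 1`, the pure-gauge chart remainder `P₂(X;H) := log(1+Φ) − H` (F2 ✓p668882), the resummation coefficient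
`g(ad X)` (`dexp X H = e^X·g(ad X)H`, ✓ `ExpDifferential.dexp_apply`; `M_X := g(ad X) − 1`), the Taylor-2 remainder `R_exp(X;H) := e^{X+H} − e^X − dexp X H` (F3b(ii) ⧗p670808).
§1 `gaugePiece_eq`: `Φ = g(ad X)H + e^{−X}R_exp(X;H)`; `gaugePiece_trisection`: `P₂ = (g(ad X)H − H) + e^{−X}R_exp(X;H) + (log(1+Φ) − Φ)`.
§2 rows of `Φ` (size `A·K`, `H`-Lipschitz `A`, `X`-Lipschitz `3A·K`; `A := e^R·e^{R+K}`), of `N₁ := e^{−X}R_exp` (`A K²∕2`, `A K`, `4∕3·A K²`) and, under the smallness `A·K ≤ ½`, of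
`N₂ := log(1+Φ) − Φ` (`2A²K²`, `2A²K`, `6A²K²`; N18 ✓ `norm_logOnePlus_sub_sub_le`).
§3 ★★ the NONLINEAR PART `𝒩(X;H) := P₂(X;H) − (g(ad X)H − H) = N₁ + N₂`: `norm_gaugeNonlin_le` (`(A∕2 + 2A²)K²`), `norm_gaugeNonlin_sub_le_of_snd` (`(A + 2A²)K‖H − H′‖`),
`norm_gaugeNonlin_sub_le_of_fst` (`(4A∕3 + 6A²)K²‖X − X′‖`), ★★ `norm_gaugeNonlin_sub_le` (joint) — exactly the three rows F1's CRUDE rule (✓p669426 `norm_divB_le_sum`) consumes: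
every `X`-Lipschitz constant carries `K²`, so `ℓ²·K² = O(‖ψ‖_X²)` is ℓ-uniform (ORDER COUNT of the LOCATE §6).  The linear part `M_X(H)` is NOT estimated here: it is resummed against
`Δ_Wψ` by F1's product rule with the coefficient rows ✓p670255 (`norm_gSer_sub_gSer_le`, `norm_gSer_secondDiff_le`, `norm_ad_sub_ad_le`) — F4.
HONEST SCOPE.  Elementary ([folklore]); constants not optimised; `NormOneClass` is assumed (used only through `‖e^{−X}‖ ≤ e^{‖X‖}`).

References: T. Bałaban, CMP 98 (1985) 17–51 [Balaban1985Averaging] ((26) p.22, (32)–(34) p.22); B. C. Hall, *Lie Groups, Lie Algebras, and Representations*, 2nd ed. (2015), Thm. 5.4 [Hall2015].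
-/

set_option autoImplicit false

noncomputable section

open NormedSpace
open scoped Nat

namespace Summit.QuantumFields.YangMills.Theorems.Prop7GaugePieceRows

open Literature.Analysis.Calculus.ExpDifferential (gSer ad dexp dexp_apply exp_neg_mul_exp_eq_one)
open Literature.Analysis.Complex (logOnePlus logOnePlus_zero norm_exp_le_exp_norm)
open YMDAG.N18.TransportOfRecord (norm_logOnePlus_sub_sub_le)
open Summit.QuantumFields.YangMills.Theorems.Prop7PowerSeriesSecondDiff (norm_exp_secondDiff_le)
open Summit.QuantumFields.YangMills.Theorems.Prop7ExpTaylorTwo (norm_expTaylorTwo_le norm_expTaylorTwo_sub_expTaylorTwo_le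
  norm_expTaylorTwo_sub_expTaylorTwo_le')

variable {E : Type*} [NormedRing E] [NormedAlgebra ℂ E] [CompleteSpace E] [NormOneClass E]

/-! ## §1 Algebra -/

omit [NormOneClass E] in
/-- `e^{−X}e^{X+H} − 1 = e^{−X}(e^{X+H} − e^X)`. [folklore] -/
theorem gaugePiece_eq' (X H : E) : exp (-X) * exp (X + H) - 1 = exp (-X) * (exp (X + H) - exp X) := by
  rw [mul_sub, exp_neg_mul_exp_eq_one (𝕂 := ℂ)]

omit [NormOneClass E] in
/-- **`Φ = g(ad X)H + e^{−X}R_exp(X;H)`** (`dexp X H = e^X g(ad X) H`). [cite: Hall2015, Thm 5.4] -/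
theorem gaugePiece_eq (X H : E) :
    exp (-X) * (exp (X + H) - exp X) = gSer ℂ (ad ℂ X) H + exp (-X) * (exp (X + H) - exp X - dexp ℂ X H) := by
  have h1 : exp (-X) * dexp ℂ X H = gSer ℂ (ad ℂ X) H := by
    rw [dexp_apply, ← mul_assoc, exp_neg_mul_exp_eq_one (𝕂 := ℂ), one_mul]
  rw [← h1, ← mul_add]
  congr 1
  abel

omit [NormOneClass E] in
/-- **TRISECTION OF THE PURE-GAUGE PIECE**: `log(1+Φ) − H = (g(ad X)H − H) + e^{−X}R_exp(X;H) + (log(1+Φ) − Φ)`. [cite: Balaban1985Averaging, (32)-(34) p.22] -/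
theorem gaugePiece_trisection (X H : E) :
    logOnePlus (exp (-X) * (exp (X + H) - exp X)) - H
      = (gSer ℂ (ad ℂ X) H - H) + exp (-X) * (exp (X + H) - exp X - dexp ℂ X H)
        + (logOnePlus (exp (-X) * (exp (X + H) - exp X)) - exp (-X) * (exp (X + H) - exp X)) := by
  have h := gaugePiece_eq X H
  generalize logOnePlus (exp (-X) * (exp (X + H) - exp X)) = Lg at *
  rw [h]
  abel

/-! ## §2 Rows of `Φ`, of `N₁ = e^{−X}R_exp` and of `N₂ = log(1+Φ) − Φ` -/

omit [NormOneClass E] in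
/-- `exp` is `e^ρ`-Lipschitz on `‖·‖ ≤ ρ` (the `a′ = b′` case of F3a's four-point row). [folklore] -/
theorem norm_exp_sub_exp_le' {a b : E} {ρ : ℝ} (ha : ‖a‖ ≤ ρ) (hb : ‖b‖ ≤ ρ) : ‖exp a - exp b‖ ≤ Real.exp ρ * ‖a - b‖ := by
  have h := norm_exp_secondDiff_le ha hb hb hb
  simp only [sub_self, sub_zero, norm_zero, zero_mul, add_zero] at h
  exact h

/-- `‖e^{−X}‖ ≤ e^R`. [folklore] -/
theorem norm_exp_neg_le {X : E} {R : ℝ} (hx : ‖X‖ ≤ R) : ‖exp (-X)‖ ≤ Real.exp R :=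
  (norm_exp_le_exp_norm _).trans (by rw [norm_neg]; exact Real.exp_le_exp.2 hx)

/-- SIZE of `Φ`: `‖e^{−X}(e^{X+H} − e^X)‖ ≤ e^R·e^{R+K}·K`. [folklore] -/
theorem norm_gaugePiece_le {X H : E} {R K : ℝ} (hx : ‖X‖ ≤ R) (hh : ‖H‖ ≤ K) :
    ‖exp (-X) * (exp (X + H) - exp X)‖ ≤ Real.exp R * Real.exp (R + K) * K := by
  have hK : 0 ≤ K := (norm_nonneg H).trans hh
  have hxh : ‖X + H‖ ≤ R + K := (norm_add_le _ _).trans (add_le_add hx hh)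
  have hxρ : ‖X‖ ≤ R + K := hx.trans (le_add_of_nonneg_right hK)
  have h1 := norm_exp_sub_exp_le' hxh hxρ
  rw [add_sub_cancel_left] at h1
  calc ‖exp (-X) * (exp (X + H) - exp X)‖ ≤ ‖exp (-X)‖ * ‖exp (X + H) - exp X‖ := norm_mul_le _ _
    _ ≤ Real.exp R * (Real.exp (R + K) * K) :=
        mul_le_mul (norm_exp_neg_le hx) (h1.trans (mul_le_mul_of_nonneg_left hh (Real.exp_pos _).le)) (norm_nonneg _) (Real.exp_pos _).le
    _ = Real.exp R * Real.exp (R + K) * K := by ring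

/-- `H`-LIPSCHITZ row of `Φ`: `‖Φ(X;H) − Φ(X;H′)‖ ≤ e^R·e^{R+K}·‖H − H′‖`. [folklore] -/
theorem norm_gaugePiece_sub_le_of_snd {X H H' : E} {R K : ℝ} (hx : ‖X‖ ≤ R) (hh : ‖H‖ ≤ K) (hh' : ‖H'‖ ≤ K) :
    ‖exp (-X) * (exp (X + H) - exp X) - exp (-X) * (exp (X + H') - exp X)‖ ≤ Real.exp R * Real.exp (R + K) * ‖H - H'‖ := by
  have hxh : ‖X + H‖ ≤ R + K := (norm_add_le _ _).trans (add_le_add hx hh)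
  have hxh' : ‖X + H'‖ ≤ R + K := (norm_add_le _ _).trans (add_le_add hx hh')
  have h1 := norm_exp_sub_exp_le' hxh hxh'
  rw [add_sub_add_left_eq_sub] at h1
  rw [← mul_sub, sub_sub_sub_cancel_right]
  calc ‖exp (-X) * (exp (X + H) - exp (X + H'))‖ ≤ ‖exp (-X)‖ * ‖exp (X + H) - exp (X + H')‖ := norm_mul_le _ _
    _ ≤ Real.exp R * (Real.exp (R + K) * ‖H - H'‖) := mul_le_mul (norm_exp_neg_le hx) h1 (norm_nonneg _) (Real.exp_pos _).le
    _ = Real.exp R * Real.exp (R + K) * ‖H - H'‖ := by ring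

/-- `X`-LIPSCHITZ row of `Φ` (factor `K`): `‖Φ(X;H) − Φ(X′;H)‖ ≤ 3·e^R·e^{R+K}·K·‖X − X′‖`. [folklore] -/
theorem norm_gaugePiece_sub_le_of_fst {X X' H : E} {R K : ℝ} (hx : ‖X‖ ≤ R) (hx' : ‖X'‖ ≤ R) (hh : ‖H‖ ≤ K) :
    ‖exp (-X) * (exp (X + H) - exp X) - exp (-X') * (exp (X' + H) - exp X')‖
      ≤ 3 * (Real.exp R * Real.exp (R + K)) * K * ‖X - X'‖ := by
  have hK : 0 ≤ K := (norm_nonneg H).trans hh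
  have hxh : ‖X + H‖ ≤ R + K := (norm_add_le _ _).trans (add_le_add hx hh)
  have hx'h : ‖X' + H‖ ≤ R + K := (norm_add_le _ _).trans (add_le_add hx' hh)
  have hxρ : ‖X‖ ≤ R + K := hx.trans (le_add_of_nonneg_right hK)
  have hx'ρ : ‖X'‖ ≤ R + K := hx'.trans (le_add_of_nonneg_right hK)
  have e : exp (-X) * (exp (X + H) - exp X) - exp (-X') * (exp (X' + H) - exp X')
      = (exp (-X) - exp (-X')) * (exp (X + H) - exp X) + exp (-X') * ((exp (X + H) - exp X) - (exp (X' + H) - exp X')) := by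
    noncomm_ring
  rw [e]
  have hA : ‖exp (-X) - exp (-X')‖ ≤ Real.exp R * ‖X - X'‖ := by
    have h := norm_exp_sub_exp_le' (a := -X) (b := -X') (ρ := R) (by rwa [norm_neg]) (by rwa [norm_neg])
    rwa [neg_sub_neg, norm_sub_rev X' X] at h
  have hB : ‖exp (X + H) - exp X‖ ≤ Real.exp (R + K) * K := by
    have h1 := norm_exp_sub_exp_le' hxh hxρ
    rw [add_sub_cancel_left] at h1
    exact h1.trans (mul_le_mul_of_nonneg_left hh (Real.exp_pos _).le)
  have hSD : ‖(exp (X + H) - exp X) - (exp (X' + H) - exp X')‖ ≤ Real.exp (R + K) * (2 * K * ‖X - X'‖) := by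
    have h := norm_exp_secondDiff_le hxh hxρ hx'h hx'ρ
    rw [add_sub_cancel_left, add_sub_cancel_left, sub_self, norm_zero, zero_add, add_sub_add_right_eq_sub] at h
    refine h.trans (mul_le_mul_of_nonneg_left ?_ (Real.exp_pos _).le)
    have h0 : 0 ≤ ‖X - X'‖ := norm_nonneg _
    nlinarith [mul_le_mul_of_nonneg_right hh h0]
  have h0 : 0 ≤ ‖X - X'‖ := norm_nonneg _
  calc ‖(exp (-X) - exp (-X')) * (exp (X + H) - exp X) + exp (-X') * ((exp (X + H) - exp X) - (exp (X' + H) - exp X'))‖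
      ≤ ‖exp (-X) - exp (-X')‖ * ‖exp (X + H) - exp X‖ + ‖exp (-X')‖ * ‖(exp (X + H) - exp X) - (exp (X' + H) - exp X')‖ :=
        (norm_add_le _ _).trans (add_le_add (norm_mul_le _ _) (norm_mul_le _ _))
    _ ≤ Real.exp R * ‖X - X'‖ * (Real.exp (R + K) * K) + Real.exp R * (Real.exp (R + K) * (2 * K * ‖X - X'‖)) :=
        add_le_add (mul_le_mul hA hB (norm_nonneg _) (by positivity)) (mul_le_mul (norm_exp_neg_le hx') hSD (norm_nonneg _) (Real.exp_pos _).le)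
    _ = 3 * (Real.exp R * Real.exp (R + K)) * K * ‖X - X'‖ := by ring

/-- SIZE of `N₁ = e^{−X}R_exp(X;H)`: `≤ e^R·e^{R+K}·K²∕2`. [cite: Hall2015, Thm 5.4] -/
theorem norm_gaugeTaylor_le {X H : E} {R K : ℝ} (hx : ‖X‖ ≤ R) (hh : ‖H‖ ≤ K) :
    ‖exp (-X) * (exp (X + H) - exp X - dexp ℂ X H)‖ ≤ Real.exp R * Real.exp (R + K) * (K ^ 2 / 2) :=
  calc ‖exp (-X) * (exp (X + H) - exp X - dexp ℂ X H)‖ ≤ ‖exp (-X)‖ * ‖exp (X + H) - exp X - dexp ℂ X H‖ := norm_mul_le _ _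
    _ ≤ Real.exp R * (Real.exp (R + K) * (K ^ 2 / 2)) :=
        mul_le_mul (norm_exp_neg_le hx) (norm_expTaylorTwo_le hx hh) (norm_nonneg _) (Real.exp_pos _).le
    _ = Real.exp R * Real.exp (R + K) * (K ^ 2 / 2) := by ring

/-- `H`-LIPSCHITZ row of `N₁` (factor `K`): `≤ e^R·e^{R+K}·K·‖H − H′‖`. [cite: Hall2015, Thm 5.4] -/
theorem norm_gaugeTaylor_sub_le_of_snd {X H H' : E} {R K : ℝ} (hx : ‖X‖ ≤ R) (hh : ‖H‖ ≤ K) (hh' : ‖H'‖ ≤ K) :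
    ‖exp (-X) * (exp (X + H) - exp X - dexp ℂ X H) - exp (-X) * (exp (X + H') - exp X - dexp ℂ X H')‖
      ≤ Real.exp R * Real.exp (R + K) * (K * ‖H - H'‖) := by
  rw [← mul_sub]
  calc ‖exp (-X) * ((exp (X + H) - exp X - dexp ℂ X H) - (exp (X + H') - exp X - dexp ℂ X H'))‖
      ≤ ‖exp (-X)‖ * ‖(exp (X + H) - exp X - dexp ℂ X H) - (exp (X + H') - exp X - dexp ℂ X H')‖ := norm_mul_le _ _
    _ ≤ Real.exp R * (Real.exp (R + K) * (K * ‖H - H'‖)) :=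
        mul_le_mul (norm_exp_neg_le hx) (norm_expTaylorTwo_sub_expTaylorTwo_le hx hh hh') (norm_nonneg _) (Real.exp_pos _).le
    _ = Real.exp R * Real.exp (R + K) * (K * ‖H - H'‖) := by ring

/-- `X`-LIPSCHITZ row of `N₁` WITH FACTOR `K²`: `≤ 4∕3·e^R·e^{R+K}·K²·‖X − X′‖`. [cite: Hall2015, Thm 5.4] -/
theorem norm_gaugeTaylor_sub_le_of_fst {X X' H : E} {R K : ℝ} (hx : ‖X‖ ≤ R) (hx' : ‖X'‖ ≤ R) (hh : ‖H‖ ≤ K) :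
    ‖exp (-X) * (exp (X + H) - exp X - dexp ℂ X H) - exp (-X') * (exp (X' + H) - exp X' - dexp ℂ X' H)‖
      ≤ 4 / 3 * (Real.exp R * Real.exp (R + K)) * K ^ 2 * ‖X - X'‖ := by
  have e : exp (-X) * (exp (X + H) - exp X - dexp ℂ X H) - exp (-X') * (exp (X' + H) - exp X' - dexp ℂ X' H)
      = (exp (-X) - exp (-X')) * (exp (X + H) - exp X - dexp ℂ X H)
        + exp (-X') * ((exp (X + H) - exp X - dexp ℂ X H) - (exp (X' + H) - exp X' - dexp ℂ X' H)) := by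
    noncomm_ring
  rw [e]
  have hA : ‖exp (-X) - exp (-X')‖ ≤ Real.exp R * ‖X - X'‖ := by
    have h := norm_exp_sub_exp_le' (a := -X) (b := -X') (ρ := R) (by rwa [norm_neg]) (by rwa [norm_neg])
    rwa [neg_sub_neg, norm_sub_rev X' X] at h
  have h0 : 0 ≤ ‖X - X'‖ := norm_nonneg _
  calc ‖(exp (-X) - exp (-X')) * (exp (X + H) - exp X - dexp ℂ X H)
        + exp (-X') * ((exp (X + H) - exp X - dexp ℂ X H) - (exp (X' + H) - exp X' - dexp ℂ X' H))‖
      ≤ ‖exp (-X) - exp (-X')‖ * ‖exp (X + H) - exp X - dexp ℂ X H‖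
        + ‖exp (-X')‖ * ‖(exp (X + H) - exp X - dexp ℂ X H) - (exp (X' + H) - exp X' - dexp ℂ X' H)‖ :=
        (norm_add_le _ _).trans (add_le_add (norm_mul_le _ _) (norm_mul_le _ _))
    _ ≤ Real.exp R * ‖X - X'‖ * (Real.exp (R + K) * (K ^ 2 / 2)) + Real.exp R * (Real.exp (R + K) * (5 / 6 * K ^ 2 * ‖X - X'‖)) :=
        add_le_add (mul_le_mul hA (norm_expTaylorTwo_le hx hh) (norm_nonneg _) (by positivity))
          (mul_le_mul (norm_exp_neg_le hx') (norm_expTaylorTwo_sub_expTaylorTwo_le' hx hx' hh) (norm_nonneg _) (Real.exp_pos _).le)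
    _ = 4 / 3 * (Real.exp R * Real.exp (R + K)) * K ^ 2 * ‖X - X'‖ := by ring

omit [NormOneClass E] in
/-- The N18 row in the small regime: `r ≤ ½` ⇒ `‖(log(1+x) − x) − (log(1+y) − y)‖ ≤ 2r‖x − y‖` for `‖x‖,‖y‖ ≤ r`. [cite: Balaban1985Averaging, (26) p.22] -/
theorem norm_logNonlin_sub_le {x y : E} {r : ℝ} (hr : r ≤ 1 / 2) (hx : ‖x‖ ≤ r) (hy : ‖y‖ ≤ r) :
    ‖(logOnePlus x - x) - (logOnePlus y - y)‖ ≤ 2 * r * ‖x - y‖ := by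
  have hr0 : 0 ≤ r := (norm_nonneg x).trans hx
  have h := norm_logOnePlus_sub_sub_le (hr.trans_lt (by norm_num)) hx hy
  refine h.trans ?_
  rw [div_le_iff₀ (by linarith)]
  have h0 : 0 ≤ ‖x - y‖ := norm_nonneg _
  nlinarith [mul_nonneg hr0 h0]

/-- SIZE of `N₂ = log(1+Φ) − Φ` under `e^R e^{R+K} K ≤ ½`: `≤ 2(e^R e^{R+K})²K²`. [cite: Balaban1985Averaging, (26) p.22] -/
theorem norm_gaugeLogNonlin_le {X H : E} {R K : ℝ} (hx : ‖X‖ ≤ R) (hh : ‖H‖ ≤ K) (hs : Real.exp R * Real.exp (R + K) * K ≤ 1 / 2) :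
    ‖logOnePlus (exp (-X) * (exp (X + H) - exp X)) - exp (-X) * (exp (X + H) - exp X)‖
      ≤ 2 * (Real.exp R * Real.exp (R + K)) ^ 2 * K ^ 2 := by
  have hΦ := norm_gaugePiece_le hx hh
  have h := norm_logNonlin_sub_le hs hΦ (y := 0) (by rw [norm_zero]; exact (norm_nonneg _).trans hΦ)
  rw [logOnePlus_zero, sub_zero, sub_zero, sub_zero] at h
  refine h.trans ?_
  have hA : 0 ≤ Real.exp R * Real.exp (R + K) * K := (norm_nonneg _).trans hΦ
  calc 2 * (Real.exp R * Real.exp (R + K) * K) * ‖exp (-X) * (exp (X + H) - exp X)‖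
      ≤ 2 * (Real.exp R * Real.exp (R + K) * K) * (Real.exp R * Real.exp (R + K) * K) := mul_le_mul_of_nonneg_left hΦ (by positivity)
    _ = 2 * (Real.exp R * Real.exp (R + K)) ^ 2 * K ^ 2 := by ring

/-- `H`-LIPSCHITZ row of `N₂` (factor `K`): `≤ 2(e^R e^{R+K})²K‖H − H′‖`. [cite: Balaban1985Averaging, (26) p.22] -/
theorem norm_gaugeLogNonlin_sub_le_of_snd {X H H' : E} {R K : ℝ} (hx : ‖X‖ ≤ R) (hh : ‖H‖ ≤ K) (hh' : ‖H'‖ ≤ K)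
    (hs : Real.exp R * Real.exp (R + K) * K ≤ 1 / 2) :
    ‖(logOnePlus (exp (-X) * (exp (X + H) - exp X)) - exp (-X) * (exp (X + H) - exp X))
        - (logOnePlus (exp (-X) * (exp (X + H') - exp X)) - exp (-X) * (exp (X + H') - exp X))‖
      ≤ 2 * (Real.exp R * Real.exp (R + K)) ^ 2 * K * ‖H - H'‖ := by
  have h := norm_logNonlin_sub_le hs (norm_gaugePiece_le hx hh) (norm_gaugePiece_le hx hh')
  refine h.trans ?_
  have hL := norm_gaugePiece_sub_le_of_snd hx hh hh'
  have hA : 0 ≤ Real.exp R * Real.exp (R + K) * K := (norm_nonneg _).trans (norm_gaugePiece_le hx hh)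
  calc 2 * (Real.exp R * Real.exp (R + K) * K) * ‖exp (-X) * (exp (X + H) - exp X) - exp (-X) * (exp (X + H') - exp X)‖
      ≤ 2 * (Real.exp R * Real.exp (R + K) * K) * (Real.exp R * Real.exp (R + K) * ‖H - H'‖) := mul_le_mul_of_nonneg_left hL (by positivity)
    _ = 2 * (Real.exp R * Real.exp (R + K)) ^ 2 * K * ‖H - H'‖ := by ring

/-- `X`-LIPSCHITZ row of `N₂` WITH FACTOR `K²`: `≤ 6(e^R e^{R+K})²K²‖X − X′‖`. [cite: Balaban1985Averaging, (26) p.22] -/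
theorem norm_gaugeLogNonlin_sub_le_of_fst {X X' H : E} {R K : ℝ} (hx : ‖X‖ ≤ R) (hx' : ‖X'‖ ≤ R) (hh : ‖H‖ ≤ K)
    (hs : Real.exp R * Real.exp (R + K) * K ≤ 1 / 2) :
    ‖(logOnePlus (exp (-X) * (exp (X + H) - exp X)) - exp (-X) * (exp (X + H) - exp X))
        - (logOnePlus (exp (-X') * (exp (X' + H) - exp X')) - exp (-X') * (exp (X' + H) - exp X'))‖
      ≤ 6 * (Real.exp R * Real.exp (R + K)) ^ 2 * K ^ 2 * ‖X - X'‖ := by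
  have h := norm_logNonlin_sub_le hs (norm_gaugePiece_le hx hh) (norm_gaugePiece_le hx' hh)
  refine h.trans ?_
  have hL := norm_gaugePiece_sub_le_of_fst hx hx' hh
  have hA : 0 ≤ Real.exp R * Real.exp (R + K) * K := (norm_nonneg _).trans (norm_gaugePiece_le hx hh)
  calc 2 * (Real.exp R * Real.exp (R + K) * K) * ‖exp (-X) * (exp (X + H) - exp X) - exp (-X') * (exp (X' + H) - exp X')‖
      ≤ 2 * (Real.exp R * Real.exp (R + K) * K) * (3 * (Real.exp R * Real.exp (R + K)) * K * ‖X - X'‖) :=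
        mul_le_mul_of_nonneg_left hL (by positivity)
    _ = 6 * (Real.exp R * Real.exp (R + K)) ^ 2 * K ^ 2 * ‖X - X'‖ := by ring

/-! ## §3 The nonlinear part `𝒩 = P₂ − M_X(H) = N₁ + N₂` -/

omit [NormOneClass E] in
/-- `𝒩(X;H) := (log(1+Φ) − H) − (g(ad X)H − H) = N₁ + N₂`. [cite: Balaban1985Averaging, (32)-(34) p.22] -/
theorem gaugeNonlin_eq (X H : E) :
    logOnePlus (exp (-X) * (exp (X + H) - exp X)) - H - (gSer ℂ (ad ℂ X) H - H)
      = exp (-X) * (exp (X + H) - exp X - dexp ℂ X H)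
        + (logOnePlus (exp (-X) * (exp (X + H) - exp X)) - exp (-X) * (exp (X + H) - exp X)) := by
  rw [gaugePiece_trisection]
  abel

/-- ★★ SIZE of the nonlinear part: `‖𝒩(X;H)‖ ≤ (A∕2 + 2A²)·K²`, `A = e^R e^{R+K}`, under `A·K ≤ ½`. [cite: Balaban1985Averaging, (32)-(34) p.22] -/
theorem norm_gaugeNonlin_le {X H : E} {R K : ℝ} (hx : ‖X‖ ≤ R) (hh : ‖H‖ ≤ K) (hs : Real.exp R * Real.exp (R + K) * K ≤ 1 / 2) :
    ‖logOnePlus (exp (-X) * (exp (X + H) - exp X)) - H - (gSer ℂ (ad ℂ X) H - H)‖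
      ≤ ((Real.exp R * Real.exp (R + K)) / 2 + 2 * (Real.exp R * Real.exp (R + K)) ^ 2) * K ^ 2 := by
  rw [gaugeNonlin_eq]
  refine (norm_add_le _ _).trans ?_
  have h1 := norm_gaugeTaylor_le hx hh
  have h2 := norm_gaugeLogNonlin_le hx hh hs
  calc _ ≤ Real.exp R * Real.exp (R + K) * (K ^ 2 / 2) + 2 * (Real.exp R * Real.exp (R + K)) ^ 2 * K ^ 2 := add_le_add h1 h2
    _ = ((Real.exp R * Real.exp (R + K)) / 2 + 2 * (Real.exp R * Real.exp (R + K)) ^ 2) * K ^ 2 := by ring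

/-- ★★ `H`-LIPSCHITZ row of the nonlinear part (factor `K`): `‖𝒩(X;H) − 𝒩(X;H′)‖ ≤ (A + 2A²)·K·‖H − H′‖`. [cite: Balaban1985Averaging, (32)-(34) p.22] -/
theorem norm_gaugeNonlin_sub_le_of_snd {X H H' : E} {R K : ℝ} (hx : ‖X‖ ≤ R) (hh : ‖H‖ ≤ K) (hh' : ‖H'‖ ≤ K)
    (hs : Real.exp R * Real.exp (R + K) * K ≤ 1 / 2) :
    ‖(logOnePlus (exp (-X) * (exp (X + H) - exp X)) - H - (gSer ℂ (ad ℂ X) H - H))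
        - (logOnePlus (exp (-X) * (exp (X + H') - exp X)) - H' - (gSer ℂ (ad ℂ X) H' - H'))‖
      ≤ ((Real.exp R * Real.exp (R + K)) + 2 * (Real.exp R * Real.exp (R + K)) ^ 2) * K * ‖H - H'‖ := by
  rw [gaugeNonlin_eq, gaugeNonlin_eq, add_sub_add_comm]
  refine (norm_add_le _ _).trans ?_
  have h1 := norm_gaugeTaylor_sub_le_of_snd hx hh hh'
  have h2 := norm_gaugeLogNonlin_sub_le_of_snd hx hh hh' hs
  calc _ ≤ Real.exp R * Real.exp (R + K) * (K * ‖H - H'‖) + 2 * (Real.exp R * Real.exp (R + K)) ^ 2 * K * ‖H - H'‖ := add_le_add h1 h2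
    _ = ((Real.exp R * Real.exp (R + K)) + 2 * (Real.exp R * Real.exp (R + K)) ^ 2) * K * ‖H - H'‖ := by ring

/-- ★★ `X`-LIPSCHITZ row of the nonlinear part WITH FACTOR `K²`: `‖𝒩(X;H) − 𝒩(X′;H)‖ ≤ (4A∕3 + 6A²)·K²·‖X − X′‖`. [cite: Balaban1985Averaging, (32)-(34) p.22] -/
theorem norm_gaugeNonlin_sub_le_of_fst {X X' H : E} {R K : ℝ} (hx : ‖X‖ ≤ R) (hx' : ‖X'‖ ≤ R) (hh : ‖H‖ ≤ K)
    (hs : Real.exp R * Real.exp (R + K) * K ≤ 1 / 2) :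
    ‖(logOnePlus (exp (-X) * (exp (X + H) - exp X)) - H - (gSer ℂ (ad ℂ X) H - H))
        - (logOnePlus (exp (-X') * (exp (X' + H) - exp X')) - H - (gSer ℂ (ad ℂ X') H - H))‖
      ≤ (4 / 3 * (Real.exp R * Real.exp (R + K)) + 6 * (Real.exp R * Real.exp (R + K)) ^ 2) * K ^ 2 * ‖X - X'‖ := by
  rw [gaugeNonlin_eq, gaugeNonlin_eq, add_sub_add_comm]
  refine (norm_add_le _ _).trans ?_
  have h1 := norm_gaugeTaylor_sub_le_of_fst hx hx' hh
  have h2 := norm_gaugeLogNonlin_sub_le_of_fst hx hx' hh hs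
  calc _ ≤ 4 / 3 * (Real.exp R * Real.exp (R + K)) * K ^ 2 * ‖X - X'‖ + 6 * (Real.exp R * Real.exp (R + K)) ^ 2 * K ^ 2 * ‖X - X'‖ :=
        add_le_add h1 h2
    _ = (4 / 3 * (Real.exp R * Real.exp (R + K)) + 6 * (Real.exp R * Real.exp (R + K)) ^ 2) * K ^ 2 * ‖X - X'‖ := by ring

/-- ★★ **JOINT LIPSCHITZ ROW OF THE NONLINEAR PART** (the row F1's crude rule consumes): for `‖X‖,‖X′‖ ≤ R`, `‖H‖,‖H′‖ ≤ K`, `A·K ≤ ½`,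
`‖𝒩(X;H) − 𝒩(X′;H′)‖ ≤ (A + 2A²)·K·‖H − H′‖ + (4A∕3 + 6A²)·K²·‖X − X′‖`. [cite: Balaban1985Averaging, (32)-(34) p.22] -/
theorem norm_gaugeNonlin_sub_le {X X' H H' : E} {R K : ℝ} (hx : ‖X‖ ≤ R) (hx' : ‖X'‖ ≤ R) (hh : ‖H‖ ≤ K) (hh' : ‖H'‖ ≤ K)
    (hs : Real.exp R * Real.exp (R + K) * K ≤ 1 / 2) :
    ‖(logOnePlus (exp (-X) * (exp (X + H) - exp X)) - H - (gSer ℂ (ad ℂ X) H - H))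
        - (logOnePlus (exp (-X') * (exp (X' + H') - exp X')) - H' - (gSer ℂ (ad ℂ X') H' - H'))‖
      ≤ ((Real.exp R * Real.exp (R + K)) + 2 * (Real.exp R * Real.exp (R + K)) ^ 2) * K * ‖H - H'‖
        + (4 / 3 * (Real.exp R * Real.exp (R + K)) + 6 * (Real.exp R * Real.exp (R + K)) ^ 2) * K ^ 2 * ‖X - X'‖ := by
  have h1 := norm_gaugeNonlin_sub_le_of_snd hx hh hh' hs
  have h2 := norm_gaugeNonlin_sub_le_of_fst hx hx' hh' hs
  rw [← sub_add_sub_cancel]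
  exact (norm_add_le _ _).trans (add_le_add h1 h2)

end Summit.QuantumFields.YangMills.Theorems.Prop7GaugePieceRows

end
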